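import Summits.Ventures.PercRepro.Night2LocalCover
import Summits.Ventures.PercRepro.Night2LocalWeights

/-!
# PercRepro — «covering + extra sets» matchings for the local form (night-2, gen 7)

The paper proofs of the local form `LocalShadowHall M q G` at `q = 2` (`proofs/NIGHT-2-local.md` §8 (C2), §13)
are fractional matchings of one shape: every member `B` receives a fixed amount `a` from each of its COVERING
sets `B ∪ {z}` (`z ∈ G ∖ cl B`) and a fixed amount `b` from each set of a family `ext B` of EXTRA shadow sets.
This file isolates the bookkeeping of that shape, at every `q`:

* `coverSets M B G` = the covering sets of `B` at `G`; they are `|G ∖ cl B|` distinct shadow sets with closure `G`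
  (`card_coverSets`, `coverSets_subset_shadowAt`);
* `coverPreimages M 𝒜 G S` = the members of `𝒜` inside `G` of which `S` is a covering set; they are determined by a
  coloop of `S` (`card_coverPreimages_le_card_coloops`), hence there are at most `q + 1` of them;
* **`localShadowHall_of_cover_extra`**: if the row sums `a·|G ∖ cl B| + b·#ext B` dominate the local demands and the
  column sums `a·#coverPreimages S + b·#{B : S ∈ ext B}` are at most `1`, then `LocalShadowHall M q G`.
-/

namespace PercRepro.Shadow

open Finset PerFlat ThmH

variable {α : Type*} [DecidableEq α] {M : Matroid α} [M.Finite]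

/-! ## Covering sets and their preimages -/

/-- The covering sets of `B` at `G`: the sets `B ∪ {z}` with `z ∈ G ∖ cl B`. -/
noncomputable def coverSets (M : Matroid α) [M.Finite] (B G : Finset α) : Finset (Finset α) :=
  (G \ clF M B).image (fun z => insert z B)

open scoped Classical in
/-- The members of `𝒜` inside `G` of which `S` is a covering set. -/
noncomputable def coverPreimages (M : Matroid α) [M.Finite] (𝒜 : Finset (Finset α)) (G S : Finset α) :
    Finset (Finset α) :=
  (membersIn M 𝒜 G).filter (fun B => S ∈ coverSets M B G)

/-- Membership in `coverSets`. -/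
theorem mem_coverSets {B G S : Finset α} : S ∈ coverSets M B G ↔ ∃ z ∈ G \ clF M B, insert z B = S := by
  unfold coverSets
  rw [Finset.mem_image]

/-- A bottom set has `|G ∖ cl B|` covering sets at `G`. -/
theorem card_coverSets {q : ℕ} {B : Finset α} (hB : B ∈ Uq M (q + 2) q) (G : Finset α) :
    (coverSets M B G).card = (G \ clF M B).card := by
  unfold coverSets
  apply Finset.card_image_of_injOn
  intro z hz z' hz' hzz'
  rw [Finset.mem_coe, Finset.mem_sdiff] at hz hz'
  have hzB : z ∉ B := notMem_of_notMem_clF hB hz.2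
  have hz'B : z' ∉ B := notMem_of_notMem_clF hB hz'.2
  have hzz'' : insert z B = insert z' B := hzz'
  have h : z ∈ insert z' B := by rw [← hzz'']; exact Finset.mem_insert_self _ _
  rw [Finset.mem_insert] at h
  rcases h with h | h
  · exact h
  · exact absurd h hzB

/-- The covering sets of a member inside `G` are shadow sets with closure `G`. -/
theorem coverSets_subset_shadowAt {q : ℕ} {𝒜 : Finset (Finset α)} (h𝒜 : 𝒜 ⊆ Uq M (q + 2) q) {G : Finset α}
    (hG : G ∈ flatsQ M (q + 1)) {B : Finset α} (hB : B ∈ membersIn M 𝒜 G) :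
    coverSets M B G ⊆ shadowAt M (q + 2) q 𝒜 G := by
  intro S hS
  rw [mem_coverSets] at hS
  obtain ⟨z, hz, rfl⟩ := hS
  exact insert_mem_shadowAt h𝒜 hG hB hz

open scoped Classical in
/-- Membership in `coverPreimages`. -/
theorem mem_coverPreimages {𝒜 : Finset (Finset α)} {G S B : Finset α} :
    B ∈ coverPreimages M 𝒜 G S ↔ B ∈ membersIn M 𝒜 G ∧ S ∈ coverSets M B G := by
  unfold coverPreimages
  rw [Finset.mem_filter]

open scoped Classical in
/-- **A covering preimage is determined by a coloop**: `S ∖ B` is a singleton `{z}` with `z` a coloop of `S`, so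
`#coverPreimages S ≤ #coloops S`. -/
theorem card_coverPreimages_le_card_coloops {q : ℕ} {𝒜 : Finset (Finset α)} (h𝒜 : 𝒜 ⊆ Uq M (q + 2) q)
    (G S : Finset α) : (coverPreimages M 𝒜 G S).card ≤ (coloops M S).card := by
  have hsing : ((coloops M S).image (fun z => ({z} : Finset α))).card = (coloops M S).card :=
    Finset.card_image_of_injective _ (fun a b h => Finset.singleton_injective h)
  rw [← hsing]
  apply Finset.card_le_card_of_injOn (fun B => S \ B)
  · intro B hB
    rw [Finset.mem_coe, mem_coverPreimages] at hB
    obtain ⟨hB1, hB2⟩ := hB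
    rw [mem_coverSets] at hB2
    obtain ⟨z, hz, rfl⟩ := hB2
    rw [Finset.mem_sdiff] at hz
    have hzB : z ∉ B := notMem_of_notMem_clF (h𝒜 (mem_membersIn.1 hB1).1) hz.2
    rw [Finset.mem_coe, Finset.mem_image]
    refine ⟨z, ?_, ?_⟩
    · rw [mem_coloops]
      refine ⟨Finset.mem_insert_self _ _, ?_⟩
      rw [Finset.erase_insert hzB]
      exact hz.2
    · show ({z} : Finset α) = insert z B \ B
      rw [Finset.insert_sdiff_of_notMem _ hzB, Finset.sdiff_self, Finset.insert_empty]
  · intro B hB B' hB' hBB'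
    rw [Finset.mem_coe, mem_coverPreimages] at hB hB'
    have h1 : B ⊆ S := by
      obtain ⟨z, -, rfl⟩ := mem_coverSets.1 hB.2
      exact Finset.subset_insert _ _
    have h2 : B' ⊆ S := by
      obtain ⟨z, -, rfl⟩ := mem_coverSets.1 hB'.2
      exact Finset.subset_insert _ _
    have hBB'' : S \ B = S \ B' := hBB'
    calc B = S \ (S \ B) := (Finset.sdiff_sdiff_eq_self h1).symm
      _ = S \ (S \ B') := by rw [hBB'']
      _ = B' := Finset.sdiff_sdiff_eq_self h2


/-! ## The «covering + extra sets» matching -/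

open scoped Classical in
/-- **The local form from a «covering + extra sets» matching.**  Every member `B` receives `a` from each of its
`|G ∖ cl B|` covering sets and `b` from each set of `ext 𝒜 B ⊆ shadowAt`; if these row sums dominate the local
demands and every shadow set `S` carries at most `1` (`a` per covering preimage, `b` per member having `S` as an
extra set), then `LocalShadowHall M q G`. -/
theorem localShadowHall_of_cover_extra {q : ℕ} {G : Finset α} (hG : G ∈ flatsQ M (q + 1))
    (a b : ℚ) (ha : 0 ≤ a) (hb : 0 ≤ b)
    (ext : Finset (Finset α) → Finset α → Finset (Finset α))
    (hext : ∀ 𝒜 ⊆ Uq M (q + 2) q, ∀ B ∈ membersIn M 𝒜 G, ext 𝒜 B ⊆ shadowAt M (q + 2) q 𝒜 G)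
    (hrow : ∀ 𝒜 ⊆ Uq M (q + 2) q, ∀ B ∈ membersIn M 𝒜 G,
      (((q : ℚ) + 2) / ((q : ℚ) + 1)) * localWeight M B G ≤
        a * ((G \ clF M B).card : ℚ) + b * ((ext 𝒜 B).card : ℚ))
    (hcol : ∀ 𝒜 ⊆ Uq M (q + 2) q, ∀ S ∈ shadowAt M (q + 2) q 𝒜 G,
      a * ((coverPreimages M 𝒜 G S).card : ℚ) +
        b * (((membersIn M 𝒜 G).filter (fun B => S ∈ ext 𝒜 B)).card : ℚ) ≤ 1) :
    LocalShadowHall M q G := by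
  apply localShadowHall_of_weights
  intro 𝒜 h𝒜
  refine ⟨fun B S => a * (if S ∈ coverSets M B G then 1 else 0) + b * (if S ∈ ext 𝒜 B then 1 else 0),
    ?_, ?_, ?_⟩
  · intro B S
    have h1 : (0 : ℚ) ≤ if S ∈ coverSets M B G then 1 else 0 := by split_ifs <;> norm_num
    have h2 : (0 : ℚ) ≤ if S ∈ ext 𝒜 B then 1 else 0 := by split_ifs <;> norm_num
    exact add_nonneg (mul_nonneg ha h1) (mul_nonneg hb h2)
  · intro S hS
    rw [Finset.sum_add_distrib, ← Finset.mul_sum, ← Finset.mul_sum, Finset.sum_boole, Finset.sum_boole]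
    exact hcol 𝒜 h𝒜 S hS
  · intro B hB
    rw [Finset.sum_add_distrib, ← Finset.mul_sum, ← Finset.mul_sum, Finset.sum_boole, Finset.sum_boole]
    have h1 : (shadowAt M (q + 2) q 𝒜 G).filter (fun S => S ∈ coverSets M B G) = coverSets M B G := by
      ext S
      rw [Finset.mem_filter]
      exact ⟨fun h => h.2, fun h => ⟨coverSets_subset_shadowAt h𝒜 hG hB h, h⟩⟩
    have h2 : (shadowAt M (q + 2) q 𝒜 G).filter (fun S => S ∈ ext 𝒜 B) = ext 𝒜 B := by
      ext S
      rw [Finset.mem_filter]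
      exact ⟨fun h => h.2, fun h => ⟨hext 𝒜 h𝒜 B hB h, h⟩⟩
    rw [h1, h2, card_coverSets (h𝒜 (mem_membersIn.1 hB).1)]
    exact hrow 𝒜 h𝒜 B hB

/-- Every shadow set has at most `q + 1` covering preimages. -/
theorem card_coverPreimages_le {q : ℕ} {𝒜 : Finset (Finset α)} (h𝒜 : 𝒜 ⊆ Uq M (q + 2) q) {G : Finset α}
    {S : Finset α} (hS : S ∈ shadowAt M (q + 2) q 𝒜 G) : (coverPreimages M 𝒜 G S).card ≤ q + 1 := by
  have hSY : S ∈ Yq M (q + 2) q := shadow_subset_Yq _ (mem_shadowAt.1 hS).1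
  have hSg : S ⊆ gr M := by
    unfold Yq at hSY
    rw [Finset.mem_filter, Finset.mem_powerset] at hSY
    exact hSY.1
  calc (coverPreimages M 𝒜 G S).card ≤ (coloops M S).card := card_coverPreimages_le_card_coloops h𝒜 G S
    _ ≤ q + 1 := card_coloops_le hSg (eRk_eq_of_mem_Yq_diag hSY)

end PercRepro.Shadow
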